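import Literature.NumberTheory.Rogawski1990.ArchOrbFamGExtCentralJetBounds   -- ★ p851299∕p851366 (A-p12 (g28)) (B3-JUNCTION): anisotropic-frame J2 closer `…_of_scalarCorner` + J2-c `…_of_isolatedModel` (hα hreal) and all its kit
import HarnessLib

/-!
# (I₁) at the PURE SCALAR CORNERS («HC-central») for the extended genuine orbital families `orbFamGExt ν′ a′` in the NONDEGENERATE diagonal frame (`α_i ≠ 0`,
# `σ_w(α_i) ∈ ℝ`) — the `hα`-twin of the anisotropic-frame J2 closer of ★ `ArchOrbFamGExtCentralJetBounds` (Harish-Chandra 1957 Thm. 2; Warner II Thm. 8.4.3.1)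

Topic `NumberTheory/Rogawski1990`; namespace `Literature.NumberTheory.Rogawski1990`.  THEOREMS ONLY (no `def`, no instance, no notation, no axiom, no named fact, no
`sorry`); kernel lane `--kind proof --supports stmt-HodgeConjecture-24833`.  Cell `pub/hodgecm-mathlib`, crux H413 (`stmt-HodgeConjecture-24833`); N8 ROAD CENSUS v0
(F0P3a-p02 (g22), fd90e2d340c810dd) §4 CUT B ∕ §5 (1) «`hα`-twins of the L1 closers» (LEAD F0P3a-plan (g14) T13-42 priority item (5); co-hand split 14:06:39Z: CROSS +
MIXED ↦ F0P3a-p02 (g22), JUMP ∕ FACES ∕ CENTRAL ∕ HEAD ↦ LH10-p02 (g8)).  Author LH10-p02 (g8).  Companions: `ArchOrbFamGExtJumpNondeg` ((I₃)), `ArchOrbFamGExtFaceJetBoundsNondeg`.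

WHY (as in the companions).  The `stub_N9` leaf's letter L1 and its ★ frame-form closers carry the anisotropy binder `hanis` of the inner form `G′ = U(diag α)`; the proofs
read it only as `hα : ∀ i, α i ≠ 0 := ne_zero_of_diagonal_anisotropic hanis`, every engine below being stated for the nondegenerate real diagonal frame (`hα`, `hreal`).
The quasi-split `G_∞ = U(Φ₃)_∞` is the same atlas at the ISOTROPIC frame `β = (½, 1, −½)` (`hherm` ✓, `hα` ✓, `hanis` ✗), so a `G`-side road (rows 2∕4∕5) imports the L1
theory through these twins.  This file: the PURE-SCALAR-CORNER stratum of (I₁) — `exists_nhds_bddAbove_norm_iteratedFDeriv_orbFamGExt_of_scalarCorner_of_ne_zero`, twin of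
★ `exists_nhds_bddAbove_norm_iteratedFDeriv_orbFamGExt_of_scalarCorner` (A-p12 (g28) ED. 2, over ★ J2-c `…_of_isolatedModel`, ★ (J2-a)∕(J2-b), ★ (B3-ENGINE)), whose conclusion
is the `hC₀` callback of ★ `smoothBounded_orbFamGExt_of_strata₄` token for token.  PROOF = the ★ body VERBATIM with `hanis` ↦ `hα` (the `have hα` line deleted); statement =
the ★ statement but for that binder; name = ★ name + `_of_ne_zero`.
HONEST LABEL: count-neutral (no leaf, no letter, no books row; LH2 «§4 NO» unchanged); HC_CM is proved only modulo the 7 printed citations (2 remaining: hLiu418 =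
`stmt-HodgeConjecture-24832`, h413 = `stmt-HodgeConjecture-24833`) until rung 0 closes.

## References
* [HarishChandra1957FourierTransforms] Harish-Chandra, *Fourier transforms on a semisimple Lie algebra II*, Amer. J. Math. 79 (1957), Thm. 2 + Lemma 40.
* [WarnerHASSLG2] G. Warner, *Harmonic Analysis on Semi-Simple Lie Groups II*, Springer (1972), Thm. 8.4.3.1.
* [Varadarajan1977] V. S. Varadarajan, *Harmonic Analysis on Real Reductive Groups*, LNM 576 (1977), Part I §1.12, §3.
* [Bouaziz1994IntegralesOrbitales] A. Bouaziz, *Intégrales orbitales sur les groupes de Lie réductifs*, Ann. Sci. ÉNS 27 (1994), §3.1 (I₁) p. 579.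
* [Rogawski1990] J. D. Rogawski, *Automorphic Representations of Unitary Groups in Three Variables*, Ann. of Math. Stud. 123 (1990), §8.2 p. 122, §8.3 p. 124.
-/

set_option autoImplicit false

noncomputable section

open MeasureTheory Measure Filter Topology Set Function Metric NumberField NumberField.InfinitePlace
open Literature.NumberTheory.Automorphic Literature.NumberTheory.Automorphic.UnitaryGroup Literature.NumberTheory.Automorphic.ArchCartan
open Literature.Geometry.ComplexHyperbolic Literature.Geometry.ComplexHyperbolic.BallModel
open Literature.MeasureTheory.Group
open scoped MatrixGroups Matrix.Norms.Operator ContDiff Classical Real NNReal ENNReal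

namespace Literature.NumberTheory.Rogawski1990

section Closer

open Literature.NumberTheory.GaloisRepresentations Literature.MeasureTheory.Group Complex


variable (L : Type) [Field L] [NumberField L] [IsCMField L] (α : Fin 3 → L)
  [MeasurableSpace ↥(arch (↥(maximalRealSubfield L)) L (IsCMField.complexConj L) 3 (Matrix.diagonal α))]
  [BorelSpace ↥(arch (↥(maximalRealSubfield L)) L (IsCMField.complexConj L) 3 (Matrix.diagonal α))]
  (ν' : Measure ↥(arch (↥(maximalRealSubfield L)) L (IsCMField.complexConj L) 3 (Matrix.diagonal α))) [ν'.IsHaarMeasure] [ν'.IsMulRightInvariant]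

/-- **(B3-JUNCTION) J2 CLOSER — (I₁) AT THE PURE SCALAR CORNERS (the `hC₀` socket of ★ `smoothBounded_orbFamGExt_of_strata₄`) — NONDEGENERATE-FRAME TWIN of ★ `exists_nhds_bddAbove_norm_iteratedFDeriv_orbFamGExt_of_scalarCorner`** (`Literature/NumberTheory/Rogawski1990/ArchOrbFamGExtCentralJetBounds.lean`): the same statement with the anisotropy binder `hanis` replaced by
`hα : ∀ i, α i ≠ 0`; proof = the ★ body verbatim (the line `have hα := ne_zero_of_diagonal_anisotropic hanis` deleted). [cite: WarnerHASSLG2, Thm. 8.4.3.1] [cite: Varadarajan1977, Part I §1.12; §3] [cite: Bouaziz1994IntegralesOrbitales, §3.1 (I₁) p. 579] [cite: Rogawski1990, §8.2 p. 122; §8.3 p. 124] -/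
theorem exists_nhds_bddAbove_norm_iteratedFDeriv_orbFamGExt_of_scalarCorner_of_ne_zero
    (hherm : ((Matrix.diagonal α).map (cmConjRingHom L)).transpose = Matrix.diagonal α)
    (hα : ∀ i, α i ≠ 0)
    (a' : ↥(arch (↥(maximalRealSubfield L)) L (IsCMField.complexConj L) 3 (Matrix.diagonal α)) → ℂ) (ha' : ArchSmooth L 3 (Matrix.diagonal α) a')
    (S' : Finset {w : InfinitePlace L // IsComplex w}) (n : ℕ) (x : {w : InfinitePlace L // IsComplex w} → Fin 3 → ℝ)
    (hcube : ∀ w' : {w : InfinitePlace L // IsComplex w}, w' ∉ S' → ∀ l : Fin 3, x w' l ∈ Set.Ico 0 (2 * Real.pi))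
    (hsc : ∃ w : {w : InfinitePlace L // IsComplex w}, w ∉ S' ∧ (∃ i j : Fin 3, i ≠ j ∧ slotSign L α w i ≠ slotSign L α w j) ∧
      (∀ l l' : Fin 3, Circle.exp (x w l) = Circle.exp (x w l')) ∧
      ∀ w', w' ∉ S' → w' ≠ w → ∀ i' j' : Fin 3, i' ≠ j' → slotSign L α w' i' ≠ slotSign L α w' j' → Circle.exp (x w' i') ≠ Circle.exp (x w' j')) :
    ∃ U ∈ nhds x, BddAbove ((fun c => ‖iteratedFDeriv ℝ n (orbFamGExt L α ν' a' S') c‖) '' (U ∩ InRegG (slotSign L α) S')) := by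
  classical
  -- junk labels: the family is identically zero
  by_cases hS' : ∀ w, w ∈ S' → w ∈ splitChartPlaces L α
  swap
  · refine ⟨univ, univ_mem, 0, ?_⟩
    rintro _ ⟨c, -, rfl⟩
    have h0 : orbFamGExt L α ν' a' S' = fun _ => 0 := orbFamGExt_of_not_admissible L α ν' a' S' hS'
    simp only [h0, iteratedFDeriv_fun_zero, Pi.zero_apply, norm_zero, le_refl]
  obtain ⟨w, hw, -, hscw, hreg'⟩ := hsc
  have hreal : ∀ (w' : {w : InfinitePlace L // IsComplex w}) (i : Fin 3), (w'.1.embedding (α i)).im = 0 := fun w' i =>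
    im_embedding_diagonal_eq_zero L 3 α (complexConj_apply_eq_of_diagonal_frame hherm) w' i
  /- (0) Borel structures on the local groups, the chart quotients, the compact-place-`≠ w` quotient -/
  letI : ∀ v : {w : InfinitePlace L // IsComplex w}, MeasurableSpace ↥(archLocal L 3 (Matrix.diagonal α) v) := fun v => borel _
  haveI : ∀ v : {w : InfinitePlace L // IsComplex w}, BorelSpace ↥(archLocal L 3 (Matrix.diagonal α) v) := fun v => ⟨rfl⟩
  haveI : ∀ v : {w : InfinitePlace L // IsComplex w}, LocallyCompactSpace ↥(archLocal L 3 (Matrix.diagonal α) v) := fun v => locallyCompactSpace_archLocal_three L α v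
  haveI : ∀ v : {w : InfinitePlace L // IsComplex w}, SecondCountableTopology ↥(archLocal L 3 (Matrix.diagonal α) v) := fun v => secondCountableTopology_archLocal_three L α v
  letI : ∀ v : {w : InfinitePlace L // IsComplex w}, MeasurableSpace (↥(archLocal L 3 (Matrix.diagonal α) v) ⧸ chartTorusGLoc L α v S') := fun v => borel _
  haveI : ∀ v : {w : InfinitePlace L // IsComplex w}, BorelSpace (↥(archLocal L 3 (Matrix.diagonal α) v) ⧸ chartTorusGLoc L α v S') := fun v => ⟨rfl⟩
  letI : MeasurableSpace ((∀ i : {w' : {w : InfinitePlace L // IsComplex w} // w' ∉ S' ∧ w' ≠ w}, ↥(archLocal L 3 (Matrix.diagonal α) i.1)) ⧸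
      Subgroup.pi Set.univ (fun i : {w' : {w : InfinitePlace L // IsComplex w} // w' ∉ S' ∧ w' ≠ w} => chartTorusGLoc L α i.1 S')) := borel _
  haveI : BorelSpace ((∀ i : {w' : {w : InfinitePlace L // IsComplex w} // w' ∉ S' ∧ w' ≠ w}, ↥(archLocal L 3 (Matrix.diagonal α) i.1)) ⧸
      Subgroup.pi Set.univ (fun i : {w' : {w : InfinitePlace L // IsComplex w} // w' ∉ S' ∧ w' ≠ w} => chartTorusGLoc L α i.1 S')) := ⟨rfl⟩
  /- (1) the product reading of `ν′`; unimodularity -/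
  obtain ⟨ν'w, hν'w, hν⟩ := exists_isHaarMeasure_eq_map_archPiEquivCM_symm_pi L 3 α ν'
  haveI : ∀ v, (ν'w v).IsHaarMeasure := hν'w
  haveI : ∀ v, (ν'w v).IsMulRightInvariant := fun v => isMulRightInvariant_of_isHaarMeasure_archLocal_diagonal_of_im_eq_zero L α hα v (hreal v) (ν'w v)
  /- (2) torus Haar measures: local `chartHaarGLoc` and `ρ_ι` on the product of the chart tori at the compact places `≠ w` -/
  haveI : ∀ v : {w : InfinitePlace L // IsComplex w}, (chartHaarGLoc L α v S').IsHaarMeasure := fun v => isHaarMeasure_chartHaarGLoc L α v S'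
  haveI : ∀ v : {w : InfinitePlace L // IsComplex w}, (chartHaarGLoc L α v S').IsInvInvariant := fun v => isInvInvariant_chartHaarGLoc L α v S'
  haveI : ∀ v : {w : InfinitePlace L // IsComplex w}, SigmaFinite (chartHaarGLoc L α v S') := fun v => sigmaFinite_chartHaarGLoc L α v S'
  obtain ⟨ρι, hρι1, hρι2, hρι⟩ := exists_haar_map_subgroupPiCoords_eq_pi
    (fun i : {w' : {w : InfinitePlace L // IsComplex w} // w' ∉ S' ∧ w' ≠ w} => chartTorusGLoc L α i.1 S') (fun i => isClosed_chartTorusGLoc L α i.1 S')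
    (fun i : {w' : {w : InfinitePlace L // IsComplex w} // w' ∉ S' ∧ w' ≠ w} => chartHaarGLoc L α i.1 S')
  haveI := hρι1
  haveI := hρι2
  /- (3) the standard split group `U(J₃)(ℂ)`: `K`, `κ`, `μ_N`, the boost torus family `τ` -/
  obtain ⟨J, hJ⟩ : ∃ J : Matrix (Fin 3) (Fin 3) ℂ, J = (StdForm.antidiagonal 3).over ℂ := ⟨_, rfl⟩
  letI : MeasurableSpace ↥(unitaryGroupOfForm (starRingEnd ℂ) J) := borel _
  haveI : BorelSpace ↥(unitaryGroupOfForm (starRingEnd ℂ) J) := ⟨rfl⟩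
  letI : MeasurableSpace (↥(unitaryGroupOfForm (starRingEnd ℂ) J) ⧸ torusU (starRingEnd ℂ) J) := borel _
  haveI : BorelSpace (↥(unitaryGroupOfForm (starRingEnd ℂ) J) ⧸ torusU (starRingEnd ℂ) J) := ⟨rfl⟩
  haveI : LocallyCompactSpace ↥(unitaryGroupOfForm (starRingEnd ℂ) J) := locallyCompactSpace_unitaryGroupOfForm_complex J
  haveI : SecondCountableTopology ↥(unitaryGroupOfForm (starRingEnd ℂ) J) := secondCountableTopology_unitaryGroupOfForm_complex J
  obtain ⟨K, hK, -, hKB⟩ := exists_isCompact_subgroup_unitary_mul_borelU hJ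
  haveI : CompactSpace ↥K := isCompact_iff_compactSpace.mp hK
  haveI : LocallyCompactSpace ↥K := hK.isClosed.isClosedEmbedding_subtypeVal.locallyCompactSpace
  obtain ⟨κ, hκ⟩ : ∃ κ : Measure ↥K, κ.IsHaarMeasure := ⟨Measure.haar, inferInstance⟩
  haveI := hκ
  have hN : IsClosed (unipotentU (starRingEnd ℂ) J : Set ↥(unitaryGroupOfForm (starRingEnd ℂ) J)) := LineRing.isClosed_unipotentU _ _
  haveI : LocallyCompactSpace ↥(unipotentU (starRingEnd ℂ) J) := hN.isClosedEmbedding_subtypeVal.locallyCompactSpace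
  obtain ⟨μN, hμN⟩ : ∃ μN : Measure ↥(unipotentU (starRingEnd ℂ) J), μN.IsHaarMeasure := ⟨Measure.haar, inferInstance⟩
  haveI := hμN
  obtain ⟨τ, hτT, hτcoe, hτmul, hτd⟩ := exists_torusU_boostEig_family hJ
  /- (4) the split frames `φ_v`, their matrices `T_v`, the Iwasawa constants `C_v` -/
  choose φ hφ hT hφT using fun v : ↥S' => exists_continuousMulEquiv_archLocal_splitChart_torusU L α v.1 hα (hS' _ v.2) hJ
  choose T hT using hT
  have hφT' : ∀ (v : ↥S') (g : ↥(archLocal L 3 (Matrix.diagonal α) v.1)), (φ v).toMulEquiv g ∈ torusU (starRingEnd ℂ) J ↔ g ∈ chartTorusGLoc L α v.1 S' :=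
    fun v g => hφT v S' hS' v.2 g
  have hφd : ∀ (v : ↥S') (cw : Fin 3 → ℝ), glDiagonal 3 ℂ (fun i => Units.mk0 (boostEig cw i) (boostEig_ne_zero cw i)) =
      ((φ v (gprimeBlockAt L α v.1 S' cw) : ↥(unitaryGroupOfForm (starRingEnd ℂ) J)) : GL (Fin 3) ℂ) := fun v cw => (hφ v S' (fun _ => cw) v.2).2.1
  have hC : ∀ v : ↥S', ∃ C : NNReal, 0 < C ∧
      (quotientMeasure (chartTorusGLoc L α v.1 S') (chartHaarGLoc L α v.1 S') (isClosed_chartTorusGLoc L α v.1 S') (ν'w v.1)).map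
          (cosetCongr (φ v).toMulEquiv (chartTorusGLoc L α v.1 S') (torusU (starRingEnd ℂ) J) (hφT' v)) = C • Measure.map
        (fun p : ↥K × ↥(unipotentU (starRingEnd ℂ) J) =>
          (QuotientGroup.mk ((p.1 : ↥(unitaryGroupOfForm (starRingEnd ℂ) J)) * (p.2 : ↥(unitaryGroupOfForm (starRingEnd ℂ) J))) :
            ↥(unitaryGroupOfForm (starRingEnd ℂ) J) ⧸ torusU (starRingEnd ℂ) J))
        (κ.prod μN) := fun v => by
    haveI := smulInvariantMeasure_quotientMeasure (chartTorusGLoc L α v.1 S') (chartHaarGLoc L α v.1 S') (isClosed_chartTorusGLoc L α v.1 S') (ν'w v.1)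
    exact exists_map_cosetCongr_eq_smul_map_of_frame hJ (chartTorusGLoc L α v.1 S') (φ v) (hφT' v) hK hKB κ μN _
      (quotientMeasure_ne_zero (chartTorusGLoc L α v.1 S') (chartHaarGLoc L α v.1 S') (isClosed_chartTorusGLoc L α v.1 S') (ν'w v.1))
  choose C _ hμC using hC
  /- (5) the ambient lift of `a′` -/
  obtain ⟨φa, hφa, hφac, -, hφaf⟩ := ha'.exists_contDiff
  /- (6) the partial unfolded model at `w`: its two J1 binders (★ (J2-b)) -/
  haveI : IsFiniteMeasureOnCompacts (Measure.pi fun _ : ↥S' => κ.prod μN) := inferInstance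
  have hΘ := contDiffOn_partialUnfoldedModel L α S' w hα hreal hS'
    (quotientMeasure (Subgroup.pi Set.univ (fun i : {w' : {w : InfinitePlace L // IsComplex w} // w' ∉ S' ∧ w' ≠ w} => chartTorusGLoc L α i.1 S')) ρι
      (isClosed_coe_pi _ fun i => isClosed_chartTorusGLoc L α i.1 S')
      (Measure.pi fun i : {w' : {w : InfinitePlace L // IsComplex w} // w' ∉ S' ∧ w' ≠ w} => ν'w i.1))
    hJ K hK (Measure.pi fun _ : ↥S' => κ.prod μN) τ hτcoe T φa hφa hφac
  obtain ⟨Cw, hCw, hzero⟩ := exists_isCompact_partialUnfoldedModel_integrand_eq_zero L α S' w hα hw T φa hφac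
  /- (7) §1 with `Θ :=` the partial unfolded model (read off `hΘ`), `hΘc` from `hzero`, and the isolation identity (★ (J2-a)) as `hIso` -/
  refine exists_nhds_bddAbove_norm_iteratedFDeriv_orbFamGExt_of_isolatedModel L α ν' S' hα hreal hS' ha' n hcube hw hscw hreg' (ν'w w) _ hΘ
    ⟨Cw, hCw, fun q k hk => ?_⟩ univ_mem
    ((∏ w' : {w' : {w : InfinitePlace L // IsComplex w} // ¬ w' = w}, ((chartHaarGLoc L α w'.1 S' (chartBoxImgGLoc L α w'.1 S')).toReal : ℂ)) *
      ((∏ v : ↥S', (C v : ℝ) : ℝ) : ℂ)) (fun c hc => ?_)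
  · -- the integrand vanishes identically off `Cw`
    refine integral_eq_zero_of_ae (Filter.Eventually.of_forall fun p => ?_)
    obtain ⟨y, η⟩ := p
    induction y using QuotientGroup.induction_on with
    | H g =>
      dsimp only
      rw [descConj_mk]
      exact hzero k hk (fun j : ↥S' => (((((η j).1 : ↥(unitaryGroupOfForm (starRingEnd ℂ) J)) *
          (τ ![0, q j.1 1, q j.1 2] * τ ![q j.1 0 / 2, 0, 0] * ((η j).2 : ↥(unitaryGroupOfForm (starRingEnd ℂ) J)) * τ ![q j.1 0 / 2, 0, 0]) *
          ((η j).1 : ↥(unitaryGroupOfForm (starRingEnd ℂ) J))⁻¹ : ↥(unitaryGroupOfForm (starRingEnd ℂ) J)) : GL (Fin 3) ℂ) : Matrix (Fin 3) (Fin 3) ℂ))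
        (g * (fun i : {w' : {w : InfinitePlace L // IsComplex w} // w' ∉ S' ∧ w' ≠ w} => gprimeBlock L α i.1 S' q) * g⁻¹)
  · -- the isolation identity (★ (J2-a), F0P3a-p05 (g21)), read in matrix currency
    have hsymm : ∀ (v : ↥S') (u : ↥(unitaryGroupOfForm (starRingEnd ℂ) J)),
        (((φ v).symm u : ↥(archLocal L 3 (Matrix.diagonal α) v.1)) : GL (Fin 3) ℂ) = (T v)⁻¹ * (u : GL (Fin 3) ℂ) * T v := fun v u => by
      have h := hT v ((φ v).symm u)
      rw [ContinuousMulEquiv.apply_symm_apply] at h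
      rw [h]
      group
    rw [orbFamG_eq_unfoldedModel_isolate_of_regG L α S' ν'w ν' hν (fun v => chartHaarGLoc L α v S') hJ φ hφT' hφd κ μN hμC τ hτT hτcoe hτmul hτd w ρι hρι
      hα hS' hw ha'.continuous ha'.hasCompactSupport hc.2]
    conv_lhs => rw [mul_assoc, mul_assoc]
    conv_rhs => rw [mul_assoc, mul_assoc]
    congr 1
    congr 1
    congr 1
    refine integral_congr_ae (Filter.Eventually.of_forall fun x => ?_)
    dsimp only
    refine integral_congr_ae (Filter.Eventually.of_forall fun p => ?_)
    obtain ⟨y, η⟩ := p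
    induction y using QuotientGroup.induction_on with
    | H g =>
      dsimp only
      rw [descConj_mk, descConj_mk, hφaf, coe_archPiEquivCM_symm_assemble]
      congr 1
      refine Matrix.ext fun a b => Prod.ext rfl (funext fun w₁ => ?_)
      simp only [Matrix.of_apply]
      split_ifs <;> first
        | rfl
        | (exfalso; exact hw (‹w₁ = w› ▸ ‹w₁ ∈ S'›))
        | (rw [hsymm, Units.val_mul, Units.val_mul])

end Closer

end Literature.NumberTheory.Rogawski1990

end

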